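import Summits.QuantumFields.YangMills.Theorems.UnitScaleTiltProp7JRowOfCurlRow
import Summits.QuantumFields.YangMills.Theorems.UnitScaleTiltProp7RRowOfJRowT3
import HarnessLib

/-!
# Route `UnitScaleTilt`, crux K1 «MinimiserStabilityRegPr» (stmt-QuantumFields-19200), route-R E′ growth side, ℛ-line — THE T³ READING OF ✓ `Prop7JRowOfCurlRow` (B-J5 DOOR AT
# THE MEMBER): the curl row (α) of the ν-summed current field, for every site field `φ`, at an SU(2) background `W` (`U := unitsField (toUField W)`) ⟹ the `hR` clause of
# ✓p678151 `Prop7HKgKOfRRow.hKgK_of_RRow_kappaRow_T3` VERBATIM, with `Cℛ` computed from `(ρ, e_K, e_M, s)` — i.e. (α) ⟹ J-ROW★ ⟹ ℛ-ROW★ ⟹ `hR` is ONE `exact`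
# (✓ `RRow_T3_of_JRow` ∘ ✓ `JRow_of_curlRow`), so the hKg-K line reads the displayed analytic rows {(α), κ-ROW′} and nothing else

Cell `ym3-torus`, width seat `ym3-torus-px19` (gen 5); companion of ✓ `Prop7JRowOfCurlRow` (same seat).  THEOREMS ONLY (0 `def`, 0 `sorry`); `--supports stmt-QuantumFields-19200`,
count-neutral.  YM₃ on T³ is a ladder rung (R3), not the Clay problem; nothing here claims (α), J-ROW★ at `IsCritR2`, hKg-K, S3, E′, a stub, the crux, d = 4 or the mass gap —
(α) is DISPLAYED (bricks B-J2∕B-J3 of LOCATE v4.2, HOME `ym-ust-19200-w4/g7/LOCATE-JROW-CURVED-V4-w4g7.md`).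

WHAT IS PROVED (ns `…Theorems.Prop7JRowOfCurlRowT3`).
* ★★★ `hR_T3_of_curlRow` — `F` a T³ family, run `K`, height `n`, `ℓ = L^{K−n}`; `W` with `‖plaqU − 1‖ ≤ a` (all index pairs), `dist1(W(∂p)) ≤ a` (all `p`), `0 < a`, `16a ≤ 1`;
  weights `0 < s`, `2sρ ≤ 1`, `0 ≤ e_K`, `0 ≤ e_M`; (α) for every `φ` at the ν-summed current field of `φ` ⟹ the `hR` clause with
  `Cℛ := 4·(2C_J + C′a²ℓ²∕(2C_J) + 6·d·a·ℓ²) + 32·d·a²·ℓ²`, `C_J := ℓ²·(s·e_K + s⁻¹ + 32a²d)`, `C′ := ℓ²·(s·e_M∕a² + 16d²)` (`d = 3`).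
HONEST SCOPE.  Composition of two landed files; no analysis.

References: T. Bałaban, CMP 99 (1985) 389–434 [Balaban1985BackgroundPropagators] ((3.4) p.391, (3.9) p.392); CMP 102 (1985) 277–309 [Balaban1985Variational] ((47)–(48)
pp.285–286, (135) p.298, Prop. 7 p.299).
-/

set_option autoImplicit false

noncomputable section

open scoped BigOperators Matrix.Norms.L2Operator Matrix

namespace Summit.QuantumFields.YangMills.Theorems.Prop7JRowOfCurlRowT3

open Literature.MathematicalPhysics.QuantumFieldTheory.Balaban1983to89
open Literature.MathematicalPhysics.QuantumFieldTheory.Balaban1983to89.T3ContinuumYM3Torus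
open B1RG242Torus
open B9Eq39Adjoint (R covD curl plaqU)
open B10Eq27TorusAxialLog (unitsField toUField)
open B9TorusCalculus (torusT)
open Summit.QuantumFields.YangMills.Theorems.Prop7CovHodgeSplit (unitsField_toUField_mem_unitary)
open Summit.QuantumFields.YangMills.Theorems.Prop7JRowOfCurlRow (JRow_of_curlRow)
open Summit.QuantumFields.YangMills.Theorems.Prop7RRowOfJRowT3 (RRow_T3_of_JRow)

/-- ★★★ **THE `hR` CLAUSE OF ✓p678151 FROM THE CURL ROW OF THE CURRENT FIELD (T³ member letters).**  `F` a T³ family, run `K`, height `n`, `ℓ = L^{K−n}`; `W` an SU(2) background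
with `‖plaqU − 1‖ ≤ a` for all index pairs and `dist1(W(∂p)) ≤ a` for all `p`, `0 < a`, `16a ≤ 1`; weights `0 < s`, `2sρ ≤ 1`, `0 ≤ e_K`, `0 ≤ e_M`.  IF for every site field `φ`
the curl row (α) `Σ_{x,μ<ν}|curl_U B_φ|²_HS ≤ ρ·CUR(φ) + e_K·K(φ) + e_M·M(φ)` holds for the ν-summed current field `B_φ` of `φ` (HS torus letters of ✓p684887 at
`U := unitsField (toUField W)`), THEN the `hR` hypothesis of ✓ `hKgK_of_RRow_kappaRow_T3` holds with `Cℛ := 4·(2C_J + C′a²ℓ²∕(2C_J) + 6·d·a·ℓ²) + 32·d·a²·ℓ²`,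
`C_J := ℓ²·(s·e_K + s⁻¹ + 32a²d)`, `C′ := ℓ²·(s·e_M∕a² + 16d²)`.  Proof: ✓ `RRow_T3_of_JRow` at `hJ := fun φ => JRow_of_curlRow … (hα φ)`.
[cite: Balaban1985Variational, Prop. 7 p.299, (135) p.298, (47)-(48) pp.285-286; Balaban1985BackgroundPropagators, (3.9) p.392] -/
theorem hR_T3_of_curlRow (F : T3Family) (K n : ℕ) (W : GaugeField (F.P K) 0 (Matrix.specialUnitaryGroup (Fin 2) ℂ)) {a : ℝ} (hapos : 0 < a)
    (hpU : ∀ (μ ν : Fin (F.P K).d) (x : Site (F.P K) 0), ‖(plaqU (torusT (F.P K) 0) (fun κ z => unitsField (toUField W) ⟨z, κ⟩) μ ν x : Matrix (Fin 2) (Fin 2) ℂ) - 1‖ ≤ a)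
    (hpH : ∀ p : Plaq (F.P K) 0, dist1 (GaugeField.plaqHol W p) ≤ a) (ha16 : 16 * a ≤ 1)
    {ρ eK eM s : ℝ} (hs : 0 < s) (hsρ : 2 * s * ρ ≤ 1) (heK : 0 ≤ eK) (heM : 0 ≤ eM)
    (hα : ∀ φ : Site (F.P K) 0 → Matrix (Fin 2) (Fin 2) ℂ,
      ∑ x : Site (F.P K) 0, ∑ μ : Fin (F.P K).d, ∑ ν : Fin (F.P K).d, (if μ < ν then
        ∑ j : Fin 2, ∑ k : Fin 2, ‖(curl (torusT (F.P K) 0) (fun κ z => unitsField (toUField W) ⟨z, κ⟩)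
          (fun μ' x' => ∑ ν' : Fin (F.P K).d,
            (R (((fun κ z => unitsField (toUField W) ⟨z, κ⟩) ν' (x'.unshift ν'))⁻¹ * plaqU (torusT (F.P K) 0) (fun κ z => unitsField (toUField W) ⟨z, κ⟩) ν' μ' (x'.unshift ν') * (fun κ z => unitsField (toUField W) ⟨z, κ⟩) ν' (x'.unshift ν'))
                  (R ((fun κ z => unitsField (toUField W) ⟨z, κ⟩) ν' (x'.unshift ν'))⁻¹ (R ((fun κ z => unitsField (toUField W) ⟨z, κ⟩) μ' (x'.unshift ν') * (fun κ z => unitsField (toUField W) ⟨z, κ⟩) ν' ((x'.unshift ν').shift μ')) (φ (((x'.unshift ν').shift μ').shift ν'))))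
              - R (plaqU (torusT (F.P K) 0) (fun κ z => unitsField (toUField W) ⟨z, κ⟩) ν' μ' x')
                  (R ((fun κ z => unitsField (toUField W) ⟨z, κ⟩) ν' (x'.unshift ν'))⁻¹ (R ((fun κ z => unitsField (toUField W) ⟨z, κ⟩) μ' (x'.unshift ν') * (fun κ z => unitsField (toUField W) ⟨z, κ⟩) ν' ((x'.unshift ν').shift μ')) (φ (((x'.unshift ν').shift μ').shift ν'))))))
          μ ν x) j k‖ ^ 2 else 0)
      ≤ ρ * (∑ x : Site (F.P K) 0, ∑ μ : Fin (F.P K).d, ∑ j : Fin 2, ∑ k : Fin 2,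
        ‖(∑ ν : Fin (F.P K).d,
            (R (((fun κ z => unitsField (toUField W) ⟨z, κ⟩) ν (x.unshift ν))⁻¹ * plaqU (torusT (F.P K) 0) (fun κ z => unitsField (toUField W) ⟨z, κ⟩) ν μ (x.unshift ν) * (fun κ z => unitsField (toUField W) ⟨z, κ⟩) ν (x.unshift ν))
                  (R ((fun κ z => unitsField (toUField W) ⟨z, κ⟩) ν (x.unshift ν))⁻¹ (R ((fun κ z => unitsField (toUField W) ⟨z, κ⟩) μ (x.unshift ν) * (fun κ z => unitsField (toUField W) ⟨z, κ⟩) ν ((x.unshift ν).shift μ)) (φ (((x.unshift ν).shift μ).shift ν))))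
              - R (plaqU (torusT (F.P K) 0) (fun κ z => unitsField (toUField W) ⟨z, κ⟩) ν μ x)
                  (R ((fun κ z => unitsField (toUField W) ⟨z, κ⟩) ν (x.unshift ν))⁻¹ (R ((fun κ z => unitsField (toUField W) ⟨z, κ⟩) μ (x.unshift ν) * (fun κ z => unitsField (toUField W) ⟨z, κ⟩) ν ((x.unshift ν).shift μ)) (φ (((x.unshift ν).shift μ).shift ν)))))) j k‖ ^ 2)
        + eK * (∑ x : Site (F.P K) 0, ∑ μ : Fin (F.P K).d, ∑ ν : Fin (F.P K).d, (if μ < ν then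
        ∑ j : Fin 2, ∑ k : Fin 2, ‖(curl (torusT (F.P K) 0) (fun κ z => unitsField (toUField W) ⟨z, κ⟩) (fun κ => covD (torusT (F.P K) 0) (fun κ z => unitsField (toUField W) ⟨z, κ⟩) κ φ) μ ν x) j k‖ ^ 2 else 0))
        + eM * (∑ x : Site (F.P K) 0, ∑ μ : Fin (F.P K).d, ∑ j : Fin 2, ∑ k : Fin 2, ‖(covD (torusT (F.P K) 0) (fun κ z => unitsField (toUField W) ⟨z, κ⟩) μ φ x) j k‖ ^ 2)) :
    ∀ (s' : Site (F.P K) 0 → Matrix (Fin 2) (Fin 2) ℂ) (Ds : PBond (F.P K) 0 → Matrix (Fin 2) (Fin 2) ℂ),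
      (∀ b : PBond (F.P K) 0, Ds b = covD (torusT (F.P K) 0) (fun κ z => unitsField (toUField W) ⟨z, κ⟩) b.dir s' b.src) →
        (((F.L : ℝ) ^ (K - n)) ^ 2) * (∑ p : Plaq (F.P K) 0, ‖((Complex.I • Ds ⟨p.src, p.μ⟩) + ((W ⟨p.src, p.μ⟩ : Matrix (Fin 2) (Fin 2) ℂ) * (Complex.I • Ds ⟨p.src.shift p.μ, p.ν⟩) * star (W ⟨p.src, p.μ⟩ : Matrix (Fin 2) (Fin 2) ℂ))
            - (((W ⟨p.src, p.μ⟩ * W ⟨p.src.shift p.μ, p.ν⟩ * (W ⟨p.src.shift p.ν, p.μ⟩)⁻¹ : Matrix.specialUnitaryGroup (Fin 2) ℂ) : Matrix (Fin 2) (Fin 2) ℂ) * (Complex.I • Ds ⟨p.src.shift p.ν, p.μ⟩) * star ((W ⟨p.src, p.μ⟩ * W ⟨p.src.shift p.μ, p.ν⟩ * (W ⟨p.src.shift p.ν, p.μ⟩)⁻¹ : Matrix.specialUnitaryGroup (Fin 2) ℂ) : Matrix (Fin 2) (Fin 2) ℂ))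
            - (((GaugeField.plaqHol W p : Matrix.specialUnitaryGroup (Fin 2) ℂ) : Matrix (Fin 2) (Fin 2) ℂ) * (Complex.I • Ds ⟨p.src, p.ν⟩) * star ((GaugeField.plaqHol W p : Matrix.specialUnitaryGroup (Fin 2) ℂ) : Matrix (Fin 2) (Fin 2) ℂ)))‖ ^ 2)
          ≤ (4 * (2 * (((F.L : ℝ) ^ (K - n)) ^ 2 * (s * eK + s⁻¹ + 32 * a ^ 2 * (F.P K).d))
                  + (((F.L : ℝ) ^ (K - n)) ^ 2 * (s * eM / a ^ 2 + 16 * ((F.P K).d : ℝ) ^ 2)) * a ^ 2 * ((F.L : ℝ) ^ (K - n)) ^ 2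
                      / (2 * (((F.L : ℝ) ^ (K - n)) ^ 2 * (s * eK + s⁻¹ + 32 * a ^ 2 * (F.P K).d)))
                  + 6 * (F.P K).d * a * ((F.L : ℝ) ^ (K - n)) ^ 2)
              + 32 * (F.P K).d * a ^ 2 * ((F.L : ℝ) ^ (K - n)) ^ 2) * (∑ b : PBond (F.P K) 0, ‖Ds b‖ ^ 2) := by
  have hUu : ∀ (ν : Fin (F.P K).d) (x : Site (F.P K) 0), (((fun κ z => unitsField (toUField W) ⟨z, κ⟩) ν x : (Matrix (Fin 2) (Fin 2) ℂ)ˣ) : Matrix (Fin 2) (Fin 2) ℂ)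
      ∈ unitary (Matrix (Fin 2) (Fin 2) ℂ) := fun ν x => unitsField_toUField_mem_unitary W ν x
  have hL1 : (1 : ℝ) ≤ F.L := by exact_mod_cast F.hL.2.le
  have hw : (0 : ℝ) < ((F.L : ℝ) ^ (K - n)) ^ 2 := by
    have : (0 : ℝ) < F.L := by linarith
    positivity
  have hd : 0 < (F.P K).d := by rw [T3Family.P_d]; norm_num
  have hCJ : 0 < ((F.L : ℝ) ^ (K - n)) ^ 2 * (s * eK + s⁻¹ + 32 * a ^ 2 * (F.P K).d) := by positivity
  have hC' : 0 ≤ ((F.L : ℝ) ^ (K - n)) ^ 2 * (s * eM / a ^ 2 + 16 * ((F.P K).d : ℝ) ^ 2) := by positivity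
  exact RRow_T3_of_JRow F K n W hapos.le hpU hpH ha16 hCJ hC'
    (fun φ => JRow_of_curlRow (fun κ z => unitsField (toUField W) ⟨z, κ⟩) hUu hapos hpU hd φ _ (fun _ _ => rfl) hw hs hsρ (hα φ))

end Summit.QuantumFields.YangMills.Theorems.Prop7JRowOfCurlRowT3

end
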